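import Literature.NumberTheory.EllipticCurves.RootNumber
import Literature.NumberTheory.DiophantineGeometry.LocalReductionProofs
import HarnessLib

/-!
# Local and global root numbers of Weierstrass curves — discharged facts

Proofs of named facts stated in `Literature.NumberTheory.EllipticCurves.RootNumber` (kept in a
sibling file so that the statement file stays a definitions/named-facts file).

* `WeierstrassCurve.hasGoodReductionAtPrime_iff_hasGoodReductionAt_holds` discharges
  `WeierstrassCurve.hasGoodReductionAtPrime_iff_hasGoodReductionAt`: for `W : WeierstrassCurve ℚ`
  and a prime `p` with associated finite place `v = primesEquiv.symm p` of `ℤ`, the `ℤ_[p]`-minimal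
  model of `W / ℚ_[p]` has good reduction iff the chosen `O_v`-minimal model of `W / ℚ_v` has
  (`v`-indexed form: `WeierstrassCurve.hasGoodReductionAtPrime_primesEquiv_iff_hasGoodReductionAt`).
* `WeierstrassCurve.hasMultiplicativeReductionAtPrime_iff_hasMultiplicativeReductionAt_holds`
  discharges `WeierstrassCurve.hasMultiplicativeReductionAtPrime_iff_hasMultiplicativeReductionAt`
  (the multiplicative analogue, for an *elliptic* `W`; `v`-indexed form
  `WeierstrassCurve.hasMultiplicativeReductionAtPrime_primesEquiv_iff_hasMultiplicativeReductionAt`,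
  transport lemma `hasMultiplicativeReduction_map_iff`; last section of this file).

## Proof architecture

Silverman's definitions (AEC VII.1, Definition of a minimal equation, PDF p. 165; VII.5,
Definition and Prop. 5.1(a), PDF p. 174) only involve the discretely valued field `(K, v)`, so they
are invariant under an isomorphism of discretely valued fields; and by VII.1, Prop. 1.3(b) the
valuation of the minimal discriminant does not depend on the chosen minimal equation. In Lean:

* `section Transport`: for DVRs `R ⊆ K`, `R' ⊆ K'` (fraction fields) and a ring isomorphism
  `e : K ≃+* K'` mapping (the image of) `R` onto (the image of) `R'`, Mathlib's predicates
  `IsIntegral`, `IsMinimal`, `HasGoodReduction` agree on `X` and `X.map e`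
  (`isIntegral_map_iff`, `isMinimal_map_iff`, `hasGoodReduction_map_iff`). Minimality is compared
  through `isMinimal_iff_of_le_one_iff` (file `LocalReduction`) for the valuation of `R'` pulled
  back along `e`, which is equivalent to the valuation of `R` (`isEquiv_valuation_comap`).
* `hasGoodReduction_iff_of_isMinimal_of_eq_smul`: two `K`-isomorphic minimal equations have good
  reduction simultaneously (`valuation_Δ_smul_eq_of_isMinimal`, file `LocalReductionProofs`).
* `section Padic`: Mathlib's continuous `ℚ`-algebra isomorphism
  `Rat.HeightOneSpectrum.adicCompletion.padicEquiv v : ℚ_v ≃A[ℚ] ℚ_[p]` (`p = primesEquiv v`) maps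
  `O_v` onto `ℤ_[p]` (`Rat.HeightOneSpectrum.adicCompletion.padicEquiv_bijOn`) and `W / ℚ_v` to
  `W / ℚ_[p]`; the image of the chosen `O_v`-minimal model is a `ℤ_[p]`-minimal equation
  `ℚ_[p]`-isomorphic to the `ℤ_[p]`-minimal model. (The `v`-indexed isomorphism is used rather than
  the `p`-indexed `PadicInt.adicCompletionIntegersEquiv ℤ p`, whose type is stated with the
  `ℤ`-algebra structure `Ring.toIntAlgebra` on `O_v`, which is not definitionally the
  `Algebra ℤ O_v` instance found when the Dedekind domain is literally `ℤ`.)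

## References

* J. H. Silverman, *The Arithmetic of Elliptic Curves*, GTM 106, 2nd ed. 2009, §VII.1 (Definition
  of a minimal equation and Prop. 1.3(b), PDF p. 165) and §VII.5 (Definition and Prop. 5.1(a),(b),
  PDF p. 174).
-/

open IsDedekindDomain

namespace WeierstrassCurve

/-! ### Transport of integrality, minimality and good reduction along an isomorphism -/

section Transport

variable {R : Type*} [CommRing R] [IsDomain R] [IsDiscreteValuationRing R]
  {K : Type*} [Field K] [Algebra R K] [IsFractionRing R K]
  {R' : Type*} [CommRing R'] [IsDomain R'] [IsDiscreteValuationRing R']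
  {K' : Type*} [Field K'] [Algebra R' K'] [IsFractionRing R' K']

open IsDiscreteValuationRing IsDedekindDomain.HeightOneSpectrum

variable (R) in
/-- The valuation ring of the normalised valuation of the fraction field `K` of a DVR `R` is (the
image of) `R`. [folklore] -/
theorem valuation_maximalIdeal_le_one_iff (x : K) :
    valuation K (maximalIdeal R) x ≤ 1 ↔ x ∈ (algebraMap R K).range :=
  ⟨fun h ↦ exists_lift_of_le_one h, fun ⟨r, hr⟩ ↦ hr ▸ valuation_le_one _ r⟩

variable (e : K ≃+* K')
  (he : ∀ x : K, e x ∈ (algebraMap R' K').range ↔ x ∈ (algebraMap R K).range)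
include he

omit [IsDomain R] [IsDiscreteValuationRing R] [IsFractionRing R K] [IsDomain R']
  [IsDiscreteValuationRing R'] [IsFractionRing R' K'] in
/-- Integrality of a Weierstrass equation is transported along a ring isomorphism of fraction
fields mapping `R` onto `R'` (Silverman, AEC VII.1: the condition is `aᵢ ∈ R`).
[cite: SilvermanAEC2009, VII.1 Definition (PDF p. 165)] -/
theorem isIntegral_map_iff (X : WeierstrassCurve K) :
    (X.map (e : K →+* K')).IsIntegral R' ↔ X.IsIntegral R := by
  simp only [isIntegral_iff_forall_mem_range, map_a₁, map_a₂, map_a₃, map_a₄, map_a₆,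
    RingHom.coe_coe, he]

/-- The normalised valuation of `R'` on `K'`, pulled back to `K` along a ring isomorphism mapping
`R` onto `R'`, is equivalent to the normalised valuation of `R` (both have valuation ring `R`).
[folklore] -/
theorem isEquiv_valuation_comap :
    (valuation K (maximalIdeal R)).IsEquiv
      ((valuation K' (maximalIdeal R')).comap (e : K →+* K')) := by
  refine isEquiv_valuation_maximalIdeal_of_le_one_iff fun x ↦ ?_
  rw [Valuation.comap_apply, RingHom.coe_coe, valuation_maximalIdeal_le_one_iff R', he]

/-- Minimality of a Weierstrass equation (Silverman, AEC VII.1, Definition, PDF p. 165: `aᵢ ∈ R`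
and `v(Δ)` minimal among such isomorphic equations) is transported along a ring isomorphism of
fraction fields of DVRs mapping `R` onto `R'`: changes of variables over `K` and `K'` correspond
under `e`, integrality corresponds, and `v' ∘ e` is equivalent to `v`.
[cite: SilvermanAEC2009, VII.1 Definition (PDF p. 165)] -/
theorem isMinimal_map_iff (X : WeierstrassCurve K) :
    (X.map (e : K →+* K')).IsMinimal R' ↔ X.IsMinimal R := by
  have hV' := valuation_maximalIdeal_le_one_iff R' (K := K')
  have hV : ∀ x : K, (valuation K' (maximalIdeal R')).comap (e : K →+* K') x ≤ 1 ↔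
      x ∈ (algebraMap R K).range := fun x ↦ by
    rw [Valuation.comap_apply, RingHom.coe_coe, hV', he]
  rw [isMinimal_iff_of_le_one_iff hV', isMinimal_iff_of_le_one_iff hV, isIntegral_map_iff e he]
  refine and_congr_right fun _ ↦ ⟨fun H C hC ↦ ?_, fun H C' hC' ↦ ?_⟩
  · have hC' : ((C.map (e : K →+* K')) • X.map (e : K →+* K')).IsIntegral R' := by
      rwa [map_variableChange, isIntegral_map_iff e he]
    simpa only [map_variableChange, map_Δ, Valuation.comap_apply] using H _ hC'
  · have hCC : C' = (C'.map (e.symm : K' →+* K)).map (e : K →+* K') := by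
      rw [VariableChange.map_map, RingEquiv.comp_symm, VariableChange.map_id]
    have hC : ((C'.map (e.symm : K' →+* K)) • X).IsIntegral R := by
      rw [← isIntegral_map_iff e he, ← map_variableChange, ← hCC]
      exact hC'
    have key := H _ hC
    rw [Valuation.comap_apply, Valuation.comap_apply] at key
    rw [hCC, map_variableChange, map_Δ, map_Δ]
    exact key

/-- Good reduction (Silverman, AEC VII.5, Definition and Prop. 5.1(a), PDF p. 174: a minimal
equation with `v(Δ) = 0`) is transported along a ring isomorphism of fraction fields of DVRs
mapping `R` onto `R'`. [cite: SilvermanAEC2009, VII.5 Prop. 5.1(a) (PDF p. 174)] -/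
theorem hasGoodReduction_map_iff (X : WeierstrassCurve K) :
    (X.map (e : K →+* K')).HasGoodReduction R' ↔ X.HasGoodReduction R := by
  rw [hasGoodReduction_iff, hasGoodReduction_iff, isMinimal_map_iff e he, map_Δ,
    (isEquiv_valuation_comap e he).eq_one_iff_eq_one, Valuation.comap_apply]

end Transport

/-! ### Good reduction does not depend on the chosen minimal model -/

section SmulInvariance

variable (R : Type*) [CommRing R] [IsDomain R] [IsDiscreteValuationRing R]
  {K : Type*} [Field K] [Algebra R K] [IsFractionRing R K]
  {W₁ W₂ : WeierstrassCurve K} [IsMinimal R W₁] [IsMinimal R W₂] {D : VariableChange K}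

/-- Two `K`-isomorphic minimal Weierstrass equations have good reduction simultaneously: good
reduction is `v(Δ) = 0` for a minimal equation (Silverman, AEC VII.5, Prop. 5.1(a)) and the two
discriminants have the same valuation (VII.1, Definition and Prop. 1.3(b);
`valuation_Δ_smul_eq_of_isMinimal`). No ellipticity hypothesis is needed.
[cite: SilvermanAEC2009, VII.5 Prop. 5.1(a) (PDF p. 174) and VII.1 Prop. 1.3(b) (PDF p. 165)] -/
theorem hasGoodReduction_iff_of_isMinimal_of_eq_smul (h : W₂ = D • W₁) :
    W₂.HasGoodReduction R ↔ W₁.HasGoodReduction R := by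
  subst h
  rw [hasGoodReduction_iff, hasGoodReduction_iff, valuation_Δ_smul_eq_of_isMinimal R W₁ D]
  exact and_congr_left' ⟨fun _ ↦ inferInstance, fun _ ↦ inferInstance⟩

end SmulInvariance

/-! ### The isomorphism `ℚ_v ≃ ℚ_[p]` and the discharge -/

section Padic

/-- The image of `ℤ_[p]` in `ℚ_[p]` is the closed unit ball `PadicInt.subring p`. [folklore] -/
theorem mem_range_algebraMap_padicInt_iff (p : ℕ) [Fact p.Prime] (y : ℚ_[p]) :
    y ∈ (algebraMap ℤ_[p] ℚ_[p]).range ↔ y ∈ (PadicInt.subring p : Set ℚ_[p]) := by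
  constructor
  · rintro ⟨z, rfl⟩
    rw [PadicInt.algebraMap_apply]
    exact z.2
  · intro h
    exact ⟨⟨y, h⟩, PadicInt.algebraMap_apply _⟩

/-- The image of `O_v` in `K_v` is `O_v`. [folklore] -/
theorem mem_range_algebraMap_adicCompletionIntegers_iff {A : Type*} [CommRing A]
    [IsDedekindDomain A] {K : Type*} [Field K] [Algebra A K] [IsFractionRing A K]
    (v : HeightOneSpectrum A) (x : v.adicCompletion K) :
    x ∈ (algebraMap (v.adicCompletionIntegers K) (v.adicCompletion K)).range ↔
      x ∈ (v.adicCompletionIntegers K : Set (v.adicCompletion K)) :=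
  ⟨fun ⟨z, hz⟩ ↦ hz ▸ z.2, fun h ↦ ⟨⟨x, h⟩, rfl⟩⟩

open Rat.HeightOneSpectrum

/-- Mathlib's `ℚ`-algebra isomorphism `padicEquiv v : ℚ_v ≃A[ℚ] ℚ_[p]` (`p = primesEquiv v`) maps
`O_v = v.adicCompletionIntegers ℚ` onto `ℤ_[p]` (`padicEquiv_bijOn`), in the form consumed by the
transport lemmas. [folklore] -/
theorem padicEquiv_mem_range_iff (v : HeightOneSpectrum ℤ) (x : v.adicCompletion ℚ) :
    haveI := Fact.mk (primesEquiv v).2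
    (adicCompletion.padicEquiv v).toAlgEquiv.toRingEquiv x ∈
        (algebraMap ℤ_[primesEquiv v] ℚ_[primesEquiv v]).range ↔
      x ∈ (algebraMap (v.adicCompletionIntegers ℚ) (v.adicCompletion ℚ)).range := by
  haveI := Fact.mk (primesEquiv v).2
  rw [mem_range_algebraMap_padicInt_iff, mem_range_algebraMap_adicCompletionIntegers_iff,
    ← (adicCompletion.padicEquiv_bijOn v).image_eq]
  exact (adicCompletion.padicEquiv v).injective.mem_set_image

/-- `v`-indexed form of the discharge: for a finite place `v` of `ℤ` and `p = primesEquiv v`, the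
`ℤ_[p]`-minimal model of `W / ℚ_[p]` has good reduction iff the chosen `O_v`-minimal model of
`W / ℚ_v` has. Transport along `e = padicEquiv v : ℚ_v ≃ ℚ_[p]` (mapping `O_v` onto `ℤ_[p]`): `e`
maps `W / ℚ_v` to `W / ℚ_[p]` and the chosen `O_v`-minimal model to a `ℤ_[p]`-minimal equation
`ℚ_[p]`-isomorphic to the `ℤ_[p]`-minimal model; good reduction (`v(Δ_min) = 0`, Silverman, AEC
VII.5, Prop. 5.1(a)) is preserved by `e` (`hasGoodReduction_map_iff`) and independent of the
minimal equation (VII.1, Prop. 1.3(b); `hasGoodReduction_iff_of_isMinimal_of_eq_smul`).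
[cite: SilvermanAEC2009, VII.5 Prop. 5.1(a) (PDF p. 174) and VII.1 Prop. 1.3(b) (PDF p. 165)] -/
theorem hasGoodReductionAtPrime_primesEquiv_iff_hasGoodReductionAt (W : WeierstrassCurve ℚ)
    (v : HeightOneSpectrum ℤ) :
    (haveI := Fact.mk (primesEquiv v).2; W.HasGoodReductionAtPrime (primesEquiv v)) ↔
      W.HasGoodReductionAt v := by
  haveI := Fact.mk (primesEquiv v).2
  have he := padicEquiv_mem_range_iff v
  -- `e` maps `W / ℚ_v` to `W / ℚ_[p]`
  have hW : (W.baseChange (v.adicCompletion ℚ)).map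
      ((adicCompletion.padicEquiv v).toAlgEquiv.toRingEquiv :
        v.adicCompletion ℚ →+* ℚ_[primesEquiv v]) = W.baseChange ℚ_[primesEquiv v] := by
    simp only [baseChange, map_map]
    exact congrArg W.map (Subsingleton.elim _ _)
  -- the two chosen minimal models
  obtain ⟨C, hC⟩ : ∃ C : VariableChange (v.adicCompletion ℚ),
      W.localMinimalModel v = C • W.baseChange (v.adicCompletion ℚ) := ⟨_, rfl⟩
  obtain ⟨D, hD⟩ : ∃ D : VariableChange ℚ_[primesEquiv v],
      (W.baseChange ℚ_[primesEquiv v]).minimal ℤ_[primesEquiv v] =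
        D • W.baseChange ℚ_[primesEquiv v] := ⟨_, rfl⟩
  haveI : ((W.localMinimalModel v).map
      ((adicCompletion.padicEquiv v).toAlgEquiv.toRingEquiv :
        v.adicCompletion ℚ →+* ℚ_[primesEquiv v])).IsMinimal ℤ_[primesEquiv v] :=
    (isMinimal_map_iff _ he _).mpr inferInstance
  have hrel : (W.baseChange ℚ_[primesEquiv v]).minimal ℤ_[primesEquiv v] =
      (D * (C.map ((adicCompletion.padicEquiv v).toAlgEquiv.toRingEquiv :
        v.adicCompletion ℚ →+* ℚ_[primesEquiv v]))⁻¹) •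
        (W.localMinimalModel v).map ((adicCompletion.padicEquiv v).toAlgEquiv.toRingEquiv :
          v.adicCompletion ℚ →+* ℚ_[primesEquiv v]) := by
    rw [hD, hC, ← map_variableChange, hW, mul_smul, inv_smul_smul]
  change ((W.baseChange ℚ_[primesEquiv v]).minimal ℤ_[primesEquiv v]).HasGoodReduction
      ℤ_[primesEquiv v] ↔ (W.localMinimalModel v).HasGoodReduction (v.adicCompletionIntegers ℚ)
  rw [hasGoodReduction_iff_of_isMinimal_of_eq_smul ℤ_[primesEquiv v] hrel,
    hasGoodReduction_map_iff _ he]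

/-- **Discharge** of the named fact `WeierstrassCurve.hasGoodReductionAtPrime_iff_hasGoodReductionAt`
(comparison of G06's prime-indexed and G22's place-indexed good-reduction predicates over `ℚ`),
from the `v`-indexed form `hasGoodReductionAtPrime_primesEquiv_iff_hasGoodReductionAt` at
`v = primesEquiv.symm p`. Silverman, AEC VII.5, Prop. 5.1(a) with VII.1, Prop. 1.3(b), transported
along the isomorphism of discretely valued fields `ℚ_v ≃ ℚ_[p]`.
[cite: SilvermanAEC2009, VII.5 Prop. 5.1(a) (PDF p. 174) and VII.1 Prop. 1.3(b) (PDF p. 165)] -/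
theorem hasGoodReductionAtPrime_iff_hasGoodReductionAt_holds (W : WeierstrassCurve ℚ) :
    W.hasGoodReductionAtPrime_iff_hasGoodReductionAt := by
  intro p
  obtain ⟨v, rfl⟩ := (primesEquiv (R := ℤ)).surjective p
  rw [Equiv.symm_apply_apply]
  exact hasGoodReductionAtPrime_primesEquiv_iff_hasGoodReductionAt W v

end Padic

end WeierstrassCurve

/-! ### Multiplicative reduction: prime-indexed versus place-indexed

Silverman, AEC VII.5, Prop. 5.1(b) (PDF p. 174): for a *minimal* Weierstrass equation, `E` has
multiplicative reduction iff `v(Δ) > 0` and `v(c₄) = 0`; VII.1, Prop. 1.3(b) (PDF p. 165–166): two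
minimal equations of an elliptic curve are related by a change of variables with `u ∈ R*`, so these
two conditions do not depend on the minimal equation. Both conditions only involve the discretely
valued field `(K, v)`, hence are transported along the isomorphism `ℚ_v ≃ ℚ_[p]`; this discharges
`WeierstrassCurve.hasMultiplicativeReductionAtPrime_iff_hasMultiplicativeReductionAt` exactly as the
good-reduction analogue above (ellipticity is needed for Prop. 1.3(b): for `Δ = 0` the two chosen
"minimal" models are unrelated arbitrary integral models). -/

namespace WeierstrassCurve

section TransportMultiplicative

variable {R : Type*} [CommRing R] [IsDomain R] [IsDiscreteValuationRing R]
  {K : Type*} [Field K] [Algebra R K] [IsFractionRing R K]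
  {R' : Type*} [CommRing R'] [IsDomain R'] [IsDiscreteValuationRing R']
  {K' : Type*} [Field K'] [Algebra R' K'] [IsFractionRing R' K']

open IsDiscreteValuationRing IsDedekindDomain.HeightOneSpectrum

variable (e : K ≃+* K')
  (he : ∀ x : K, e x ∈ (algebraMap R' K').range ↔ x ∈ (algebraMap R K).range)
include he

/-- Multiplicative reduction (Silverman, AEC VII.5, Definition and Prop. 5.1(b), PDF p. 174: a
minimal equation with `v(Δ) > 0` and `v(c₄) = 0`) is transported along a ring isomorphism of
fraction fields of DVRs mapping `R` onto `R'` (minimality by `isMinimal_map_iff`; the two valuation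
conditions because `v' ∘ e` is equivalent to `v`, `isEquiv_valuation_comap`).
[cite: SilvermanAEC2009, VII.5 Prop. 5.1(b) (PDF p. 174)] -/
theorem hasMultiplicativeReduction_map_iff (X : WeierstrassCurve K) :
    (X.map (e : K →+* K')).HasMultiplicativeReduction R' ↔ X.HasMultiplicativeReduction R := by
  rw [hasMultiplicativeReduction_iff, hasMultiplicativeReduction_iff, isMinimal_map_iff e he, map_Δ,
    map_c₄, (isEquiv_valuation_comap e he).lt_one_iff_lt_one,
    (isEquiv_valuation_comap e he).eq_one_iff_eq_one, Valuation.comap_apply, Valuation.comap_apply]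

end TransportMultiplicative

section PadicMultiplicative

open Rat.HeightOneSpectrum

/-- `v`-indexed form: for an *elliptic* `W / ℚ`, a finite place `v` of `ℤ` and `p = primesEquiv v`,
the `ℤ_[p]`-minimal model of `W / ℚ_[p]` has multiplicative reduction iff the chosen `O_v`-minimal
model of `W / ℚ_v` has. Transport along `e = padicEquiv v : ℚ_v ≃ ℚ_[p]` (mapping `O_v` onto
`ℤ_[p]`): `e` maps `W / ℚ_v` to `W / ℚ_[p]` and the chosen `O_v`-minimal model to a `ℤ_[p]`-minimal
equation `ℚ_[p]`-isomorphic to the `ℤ_[p]`-minimal model; multiplicative reduction (`v(Δ) > 0`,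
`v(c₄) = 0` for a minimal equation, Silverman, AEC VII.5, Prop. 5.1(b)) is preserved by `e`
(`hasMultiplicativeReduction_map_iff`) and, for `Δ ≠ 0`, independent of the minimal equation
(VII.1, Prop. 1.3(b): `u ∈ R*`; `hasMultiplicativeReduction_iff_of_isMinimal_of_eq_smul`).
[cite: SilvermanAEC2009, VII.5 Prop. 5.1(b) (PDF p. 174) and VII.1 Prop. 1.3(b) (PDF p. 165)] -/
theorem hasMultiplicativeReductionAtPrime_primesEquiv_iff_hasMultiplicativeReductionAt
    (W : WeierstrassCurve ℚ) [W.IsElliptic] (v : HeightOneSpectrum ℤ) :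
    (haveI := Fact.mk (primesEquiv v).2; W.HasMultiplicativeReductionAtPrime (primesEquiv v)) ↔
      W.HasMultiplicativeReductionAt v := by
  haveI := Fact.mk (primesEquiv v).2
  have he := padicEquiv_mem_range_iff v
  -- `e` maps `W / ℚ_v` to `W / ℚ_[p]`
  have hW : (W.baseChange (v.adicCompletion ℚ)).map
      ((adicCompletion.padicEquiv v).toAlgEquiv.toRingEquiv :
        v.adicCompletion ℚ →+* ℚ_[primesEquiv v]) = W.baseChange ℚ_[primesEquiv v] := by
    simp only [baseChange, map_map]
    exact congrArg W.map (Subsingleton.elim _ _)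
  -- the two chosen minimal models
  obtain ⟨C, hC⟩ : ∃ C : VariableChange (v.adicCompletion ℚ),
      W.localMinimalModel v = C • W.baseChange (v.adicCompletion ℚ) := ⟨_, rfl⟩
  obtain ⟨D, hD⟩ : ∃ D : VariableChange ℚ_[primesEquiv v],
      (W.baseChange ℚ_[primesEquiv v]).minimal ℤ_[primesEquiv v] =
        D • W.baseChange ℚ_[primesEquiv v] := ⟨_, rfl⟩
  haveI : ((W.localMinimalModel v).map
      ((adicCompletion.padicEquiv v).toAlgEquiv.toRingEquiv :
        v.adicCompletion ℚ →+* ℚ_[primesEquiv v])).IsMinimal ℤ_[primesEquiv v] :=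
    (isMinimal_map_iff _ he _).mpr inferInstance
  have hrel : (W.baseChange ℚ_[primesEquiv v]).minimal ℤ_[primesEquiv v] =
      (D * (C.map ((adicCompletion.padicEquiv v).toAlgEquiv.toRingEquiv :
        v.adicCompletion ℚ →+* ℚ_[primesEquiv v]))⁻¹) •
        (W.localMinimalModel v).map ((adicCompletion.padicEquiv v).toAlgEquiv.toRingEquiv :
          v.adicCompletion ℚ →+* ℚ_[primesEquiv v]) := by
    rw [hD, hC, ← map_variableChange, hW, mul_smul, inv_smul_smul]
  -- the transported local minimal model is an elliptic curve (`Δ ≠ 0` is preserved by `e`)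
  haveI := W.isElliptic_localMinimalModel v
  have hΔ : ((W.localMinimalModel v).map ((adicCompletion.padicEquiv v).toAlgEquiv.toRingEquiv :
      v.adicCompletion ℚ →+* ℚ_[primesEquiv v])).Δ ≠ 0 := by
    rw [map_Δ]
    exact (map_ne_zero _).mpr (W.localMinimalModel v).isUnit_Δ.ne_zero
  change ((W.baseChange ℚ_[primesEquiv v]).minimal ℤ_[primesEquiv v]).HasMultiplicativeReduction
      ℤ_[primesEquiv v] ↔
    (W.localMinimalModel v).HasMultiplicativeReduction (v.adicCompletionIntegers ℚ)
  rw [hasMultiplicativeReduction_iff_of_isMinimal_of_eq_smul ℤ_[primesEquiv v] hrel hΔ,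
    hasMultiplicativeReduction_map_iff _ he]

/-- **Discharge** of the named fact
`WeierstrassCurve.hasMultiplicativeReductionAtPrime_iff_hasMultiplicativeReductionAt` (comparison of
G06's prime-indexed and G22's place-indexed multiplicative-reduction predicates over `ℚ`, for an
elliptic `W`), from the `v`-indexed form
`hasMultiplicativeReductionAtPrime_primesEquiv_iff_hasMultiplicativeReductionAt` at
`v = primesEquiv.symm p`. Silverman, AEC VII.5, Prop. 5.1(b) with VII.1, Prop. 1.3(b), transported
along the isomorphism of discretely valued fields `ℚ_v ≃ ℚ_[p]`.
[cite: SilvermanAEC2009, VII.5 Prop. 5.1(b) (PDF p. 174) and VII.1 Prop. 1.3(b) (PDF p. 165)] -/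
theorem hasMultiplicativeReductionAtPrime_iff_hasMultiplicativeReductionAt_holds
    (W : WeierstrassCurve ℚ) : W.hasMultiplicativeReductionAtPrime_iff_hasMultiplicativeReductionAt := by
  intro _ p
  obtain ⟨v, rfl⟩ := (primesEquiv (R := ℤ)).surjective p
  rw [Equiv.symm_apply_apply]
  exact hasMultiplicativeReductionAtPrime_primesEquiv_iff_hasMultiplicativeReductionAt W v

end PadicMultiplicative

end WeierstrassCurve
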